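import Mathlib
import HarnessLib
import HarnessLib.Audit
import Summits.Parity.Statement
import Literature.NumberTheory.Sieve.FordMaynardSieveBoundG1
import Literature.NumberTheory.Sieve.FordMaynardLevelHalfThresholds
import HarnessLib.Audit.Status.Attr

/-!
Route: FordMaynardSieveConst01651

CLOSED (proved) 2026-09-01T00:28:58Z by planner-decomp-parity-writer-1-g27-0 — reason: proved:Summit.Parity.GeneralizedHardyLittlewood.Theses.FordMaynardSieveConst01651.sieveConst01651_proof — note: success close on the operator's SUMMON docket (HOME/wake/…/SUMMON-decomp-parity-writer-1-20260831T232917Z.md df1ad394b37423ae, priority36b shard-B pen, on 21-frontier LD l.24455 (2) «LET FINISH»; PARITY.md ON-WAKE 1) by the route's tenure planner decomp-parity-writer-1 g27: TARGET stmt-Parity-19185 . The file is kept as the record of this route; refuted decls are indexed as negative knowledge (`ledger negatives`).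

# Route FordMaynardSieveConst01651 — a positive linear-sieve constant on [0.1651, 1/3) at level 1/2
from one certified (1*g)-certificate

RUNG ROUTE, b-side of the ν*(1/2, 0) window (D-0059/D-0061, class rung; closes the rung leaf
`Summit.Parity.GeneralizedHardyLittlewood.LowerSieveThreshold01651 :=
FordMaynard.LowerSieveThresholdAt (1651/10000)` — Ford–Maynard
Theorem 2.7 (b) moved from 0.1663 to 0.1651: for every ν ∈ [0.1651, 1/3) SOME c > 0 is an admissible
lower-bound linear-sieve constant at
(γ, θ, ν) = (1/2, 0, ν); never summit credit). CONDITIONAL BRIDGE on the named Literature fact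
`FordMaynard2024_thm73a_levelHalf`
(Ford–Maynard Theorem 7.3 (a) at P = (1/2, 0, ν), a printed theorem, unformalised; landed as p406831
and kept as the support item
FMThm73aLevelHalf so that `closes` names it). Given the bridge it suffices to show X = GCert01651: a
symmetric g, piecewise constant on
half-open convex polytopes of the ordered cone, with g(∅) = 1, supported on {all xᵢ > 0.1651, Σ xᵢ <
1/2}, with (𝟙⋆g)(x) ≤ 0 at every x of
dimension ≥ 2 with Σ xᵢ = 1 and all xᵢ ∈ (0.1651, 0.8349), and with V(0.1651, g) = sieveBoundG1
(1651/10000) g > 0 — the cell's certified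
LP optimiser (kit j242906). Then `.exists_pos` gives c > 0 at ν = 0.1651 and
`IsLowerSieveConst.mono` carries it to every ν ≥ 0.1651.
Lean: `∃ g : Literature.NumberTheory.Sieve.FordMaynard.VecFn, g.IsSymmetric ∧
Literature.NumberTheory.Sieve.FordMaynard.IsPiecewiseConstOnCone g ∧ (∀ e : Fin 0 → ℝ, g 0 e = 1) ∧
(∀ (k : ℕ) (x : Fin k → ℝ), g k x ≠ 0 → k = 0 ∨ ((∀ i, (1651 / 10000 : ℝ) < x i) ∧ ∑ i, x i < 1 /
2)) ∧ (∀ k : ℕ, 2 ≤ k → ∀ x : Fin k → ℝ, (∀ i, (1651 / 10000 : ℝ) < x i ∧ x i < 1 - 1651 / 10000) →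
∑ i, x i = 1 → Literature.NumberTheory.Sieve.FordMaynard.starSum g k x ≤ 0) ∧ 0 <
Literature.NumberTheory.Sieve.FordMaynard.sieveBoundG1 (1651 / 10000) g`

## Assembly
Pure logic over the landed p406831/p405840: from GCert01651 obtain g and its six properties;
`FordMaynard2024_thm73a_levelHalf.exists_pos`
(with 0 < 1651/10000 < 1/4 by norm_num) gives c > 0 with IsLowerSieveConst (1/2) 0 (1651/10000) c;
for ν ∈ [0.1651, 1/3),
`IsLowerSieveConst.mono` (monotone in ν) gives IsLowerSieveConst (1/2) 0 ν c. That 6-line argument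
is the ASSEMBLY item (PROVED:
`assembly_holds` in SketchB.lean / SketchB_inline.lean, rc 0, axioms
propext/Classical.choice/Quot.sound) and the deciding theorem is
`closes (hA : Assembly) (h1 : GCert01651) (h2 : FMThm73aLevelHalf) : SieveConst01651 := hA h1 h2`
(glue.lean), so that every declared item is
in the cone of `closes` (BC6). Until the target is registered as ALT-CLOSER the gate reads this as
conclusion-mismatch and the route is DRAFT by
design; `ledger route edit <id> --closes-target <registered FQN> --closes-file glue.lean` then
serves it.
By-product for the closing Theorems file (lit note 2026-08-25T20:54Z, not an item): the 2-line
corollary that the leaf gives clause 1 of the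
printed named fact `FordMaynard2024_thm27b` (∀ ν ∈ [0.1663, 1/3), ∃ c > 0, …) via
`LowerSieveThresholdAt.mono` / `lowerSieveThresholdAt_printed`,
so the tree records that the printed first clause is certified modulo Theorem 7.3 (a); clause 2
(divisor-bounded ε-family) would need
FM Theorem 8.3 as a further fact and is out of scope.

CLOSES_TARGET: closes rung F-P1 of Parity: Summit.Parity.GeneralizedHardyLittlewood.Theses.FordMaynardSieveConst01651.SieveConst01651 (D-0061; not the summit Statement) — the deciding theorem of this route concludes that registered leaf instead of the Statement decl `GeneralizedHardyLittlewood` (class rung: servable and labelled, never counted as concluding the summit Statement).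

CONDITIONAL on Literature.NumberTheory.Sieve.FordMaynard.FordMaynard2024_thm73a_levelHalf — this route is an explicit reduction to that named conjecture (D-0019: crux floor waived).

Rationale: WHY THIS LINE. Ford–Maynard (arXiv:2407.14368, Theorem 2.7 (b), §8) prove C⁻(1/2, 0, ν) > 0 for ν >
0.1663 by exhibiting a g ∈ 𝒮𝒢₁ with (𝟙⋆g) ≤ 0 on
ℋ(P) and V(ν, g) > 0 in Theorem 7.3 (a) (their Mathematica LP, 80 digits, root 0.1662296). The cell
re-solved that LP on a finer family
(1370 two-dimensional + 2 three-dimensional cells, n₁ = 72) and CERTIFIED the optimiser at ν =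
1651/10000: (𝟙⋆g) ≤ 0 checked in exact
rationals on all 153 050 cell types of ℋ (1 818 marginal rows proved empty by exact simplex, FAIL =
0) and V = 0.002706498 ± 3.7·10⁻¹⁰ > 0
in Arb balls (kit j242906; backup 0.1652, j242907; refereed) — the first statement about the b-side
of ν*(1/2, 0) not in print. The
statement layer making Theorem 7.3 (a) a named fact with exactly these hypotheses (starSum =
Definition 7.1, IsPiecewiseConstOnCone ⊆ 𝒮𝒢₁,
sieveBoundG1 = (7.1) with Lemma 8.4's description of ℋ, corollary `.exists_pos`) landed on
2026-08-25 (p406831), so the rung is a kernel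
theorem modulo the printed Theorem 7.3 (a) and ONE finite certificate. Imported area: LP duality /
certified computation (interval
arithmetic, exact rational LP) pointed at sieve theory. It complements route
FordMaynardNoSieveConst0164 (c-side, no constant at 0.164):
together they pin ν*(1/2, 0) ∈ (0.164, 0.1651].

RANKED CRUXES. #0 SieveConst01651 (target) — the rung leaf itself, as this route's target item: for
every ν ∈ [0.1651, 1/3) some c > 0 is an admissible lower-bound linear-sieve constant at (1/2, 0, ν)
— identical by `rfl` to the operator leaf
`Summit.Parity.GeneralizedHardyLittlewood.LowerSieveThreshold01651` if/when that is landed;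
registered (or to be registered) as the rung's ALT-CLOSER (D-0061), after which `route edit
--closes-target` makes the route served. (why it might fail: only if the certificate GCert01651 is
wrong (V-margin 2.7·10⁻³) or the named fact Theorem 7.3 (a) is mis-transcribed — the bridge is
declared.) [FordMaynard2024PrimeSieves, arXiv:2407.14368]
#2 GCert01651 (crux) — there is a symmetric vector function g, piecewise constant on (half-open)
convex polytopes inside the ordered cone in each dimension, with g(∅) = 1, g_k(x) ≠ 0 only if all xᵢ
> 0.1651 and Σ xᵢ < 1/2, such that (𝟙⋆g)(x) = Σ_{A ⊆ [k]} g(x_A) ≤ 0 for every k ≥ 2 and every x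
with Σ xᵢ = 1 and all xᵢ ∈ (0.1651, 1 − 0.1651), and V(0.1651, g) = 1 + Σ_{k=2}^{6} ∫_{ordered
ℋ-slice} (𝟙⋆g)(x)/(x₁⋯x_k) > 0 — the cell's certified LP optimiser (spec spec_lp_01651_72.json, kit
j242906). [difficulty: L] (why it might fail: V-margin is only 2.7·10⁻³: the replay needs certified
two-sided enclosures of ~1.4·10³ log/dilog-valued cell integrals in the tree's sliceIntegral
normalisation, and (𝟙⋆g) ≤ 0 must hold POINTWISE on ℋ incl. cell faces (half-open decomposition),
not just per cell type.) [FordMaynard2024PrimeSieves, arXiv:2407.14368]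
#9 FMThm73aLevelHalf (support) — the declared bridge — Ford–Maynard Theorem 7.3 (a) at P = (1/2, 0,
ν), 0 < ν < 1/4, for symmetric g piecewise constant on polytopes of the ordered cone (named
Literature fact, p406831; a printed theorem whose 20-page proof, §7 with §4–5, is unformalised).
Kept as an item so that the deciding theorem names it; closing it = formalising FM §7. [difficulty:
XL] [FordMaynard2024PrimeSieves, arXiv:2407.14368]

TWO-LAYER PLAN. GCert01651 needs no item-level split: the prover's layer (lemmas `--supports
GCert01651`) is (i) the cell table of spec_lp_01651_72.json as a
`VecFn` that is a finite sum of indicators of DISJOINT half-open polytopes of the ordered cone,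
symmetrised (IsSymmetric, IsPiecewiseConstOnCone,
support, g(∅) = 1 by `decide`/`norm_num`-level facts); (ii) (𝟙⋆g) ≤ 0 pointwise on ℋ: on each of the
153 050 cell types (𝟙⋆g) is a
constant = a rational sum of table entries ≤ 0 (exact table check), faces included by the half-open
convention; (iii) V > 0: `sieveBoundG1`
unfolds to 1 + Σ_{k=2..6} Σ_cells c·∫_{cell ∩ {Σ=1}} dx/Πxᵢ, each integral enclosed two-sidedly
(closed forms in log/dilog or validated
quadrature, Arb values in evidence) with total error < 2.7·10⁻³.

KILL CRITERIA. A proof of `FordMaynard.NoLowerSieveConstAt ν₁` for some ν₁ ≥ 0.1651 (a certified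
NEGATIVE Type-I* witness there, as in route
FordMaynardNoSieveConst0164) refutes the leaf and closes the route `refuted:GCert01651`. An exact
re-evaluation showing V(0.1651, g) ≤ 0 for
the spec kills GCert01651 as a certificate — pivot to the backup point 0.1652 (j242907) or 0.1655
(j242728, larger margin) with the leaf
instance changed by the operator. A refutation of the named fact as TYPED (misstatement of Theorem
7.3 (a)'s instance) sends the bridge
back to the lit seat (restate), not to the bin.

NOT DECOMPOSED YET. The certificate format (cell grid n₁ = 72 as half-open polytopes, the rational
table, the list of ~1.4·10³ cell integrals with two-sided
rational enclosures) and the enclosure lemmas for ∫ dx/Πxᵢ over polytope slices (log/dilog values)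
are the prover's layer under
GCert01651 and deliberately not pre-typed (their shape depends on how the prover evaluates
`sliceIntegral` on indicator data). The bridge
FMThm73aLevelHalf is not decomposed: it is Ford–Maynard §7 verbatim.

CHEAPEST FALSIFIER. Re-run the cell's certificate job (evidence: spec_lp_01651_72.json +
fm27_lp2.py/fm27_cert.py, ≈ 80 s on kit): (H1) must print FAIL = 0 over
153 050 types and (H2) OBJ = 0.002706498 ± 4e−10 — DONE (kit j242906 by the cell; referee
PASS—REPRODUCED, STATUS 2026-08-25T19:52Z). Next
cheapest: check by hand that the tree's `sliceIntegral 2 1` of 𝟙[a<x₁<b]/(x₁x₂) on {x₁+x₂=1} equals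
the cell's D₂ convention
(∫ dx₁/(x₁(1−x₁))) on one cell — a normalisation slip is the only way the certified number and the
Lean number can differ.

NUMBERS. Printed: C⁻(1/2, 0, ν) > 0 for ν > 0.1662296 (FordMaynard2024PrimeSieves Thm 2.7 (b), §8,
their g). Cell, certified g-side: 0.166
(j242723), 0.1655 (j242728), 0.1652 (j242907), 0.1651 (j242906: V = 0.002706498 ± 3.7·10⁻¹⁰, 153 050
types FAIL = 0); fine scan n₁ = 72:
V(0.1651) = +0.0027 … V(0.1654) = +0.0061; 0.165 at n₁ = 120 pending (j243098). c-side (other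
route): no constant at 0.164. Items at open: 3
(GCert01651 = the certificate, crux; FMThm73aLevelHalf = the declared bridge, support; assembly);
both statement items are binders of `closes`.

DEFINITION REQUESTS. None new: starSum, IsPiecewiseConstOnCone, sieveBoundG1,
FordMaynard2024_thm73a_levelHalf (+ `.exists_pos`) landed as p406831;
LowerSieveThresholdAt (p405840), IsLowerSieveConst.mono exist. ALT-CLOSER (D-0061, class rung, rung
F-P1) — either of two registrations serves this route: (i) register THIS route's target decl
`Summit.Parity.GeneralizedHardyLittlewood.Theses.FordMaynardSieveConst01651.SieveConst01651`
(precedents: Hodge H1/H2, YangMills R2a–d point at Theses decls; no file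
landing needed), then `ledger route edit <id> --closes-target <that FQN> --closes-file glue.lean`;
or (ii) land the operator leaf
`Summit.Parity.GeneralizedHardyLittlewood.LowerSieveThreshold01651` (text
HOME/parity-ideate-lit/leaves/LowerSieveThreshold01651.lean, same body by `rfl`) and register it,
then the same edit with a glue ending `:= by unfold
Summit.Parity.GeneralizedHardyLittlewood.LowerSieveThreshold01651; exact hA …` and the target item
retriaged `aside`. The route is opened DRAFT before either (conclusion-mismatch by design).

Novelty: Searches (2026-08-25): `lit search --hybrid "Ford Maynard theory of prime detecting sieves Type II
range threshold linear sieve constant" -n 8` (8 book hits, none on the (1/2,0,ν) threshold)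
[corpus:book:harman2007-prime-detecting-sieves p.7]; `lit citing arxiv:2407.14368` (3 citing papers,
none computes thresholds) [graph:arxiv:2407.14368]; `lit galaxy search "Ford-Maynard|prime-detecting
sieves|Type II information" --star all -n 10` (hits = the paper itself and Harman's book)
[galaxy:pdf:2407.14368]; `lean search 'sieveBoundG1'` (p406831 only).
Nearest prior art found: FordMaynard2024PrimeSieves (arXiv:2407.14368) Theorem 2.7 (b) itself —
C⁻(1/2, 0, ν) > 0 for ν > 0.1663 by an LP optimiser computed in Mathematica to 80 digits (ancillary
files), no machine-checkable certificate.
Delta: moves the printed b-side threshold 0.1663 to 0.1651 with an exact-rational/Arb certificate on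
a finer LP family and makes it a kernel target conditional only on the printed Theorem 7.3 (a),
complementing the c-side route (window (0.164, 0.1651]).
Claimed grade: variant  [refs: 2407.14368, book:harman2007-prime-detecting-sieves, arxiv:2407.14368]

Barriers (technique_class: sieve-lp-duality, certified-computation): - technique_class: sieve-lp-duality, certified-computation
- Literature.Barriers.Parity.FordMaynardMinimalTypeII: not evaded — USED in the positive direction:
the barrier says some Type-II information is necessary; the route quantifies how much suffices at
level 1/2 (Type-II range (ν, 2ν] ∪ [1−2ν, 1−ν) with ν ≥ 0.1651).
- Literature.Barriers.Parity.SelbergParityBarrier: consistent — a lower-bound sieve constant c > 0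
is obtained only WITH Type-II (bilinear) information in the hypothesis, exactly the input parity
says the linear sieve alone lacks.
- Literature.Barriers.Parity.LinearSieveOptimality: not applicable — that barrier concerns the
β-sieve without Type-II information.
- Negatives index: empty near this line at filing (4 Parity negatives, none involves
IsLowerSieveConst / sieveBoundG1).

History (route lifecycle, newest last):
- 2026-08-26T01:37:03Z · closes_target -> closes rung F-P1 of Parity: Summit.Parity.GeneralizedHardyLittlewood.Theses.FordMaynardSieveConst01651.SieveConst01651 (D-0061; not the summit Statement) (planner-parity-ideate-p3-g4-0)
- 2026-08-31T14:50:38Z · BROKEN — GCert01651 (stmt-Parity-19186, crux) refuted by Summit.Parity.GeneralizedHardyLittlewood.Theorems.FordMaynardSieveConst01651GCert01651_refuted (refuter-decomp-parity-crit-1-g32-0)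
- 2026-08-31T15:27:10Z · rev 4: dropped GCert01651 — repair step 3/3 (un-BREAK; precedent PrimeLevelFamEdge rev 6): drop the want of GCert01651 (stmt-Parity-19186, closed·refuted-misstated by Summit.Parity.General (planner-decomp-parity-writer-1-g24-0)
- 2026-08-31T15:27:10Z · REPAIRED (drop GCert01651) — back to open: repair step 3/3 (un-BREAK; precedent PrimeLevelFamEdge rev 6): drop the want of GCert01651 (stmt-Parity-19186, closed·refuted-misstated by Summit.Parity.General (planner-decomp-parity-writer-1-g24-0)
- 2026-09-01T00:28:58Z · CLOSED proved — proved:Summit.Parity.GeneralizedHardyLittlewood.Theses.FordMaynardSieveConst01651.sieveConst01651_proof (planner-decomp-parity-writer-1-g27-0)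

sub-problem: GeneralizedHardyLittlewood · status: closed(proved) · opened planner-parity-ideate-p3-g2-0 2026-08-25T21:19:12Z · rev 5 · ledger route-Parity-FordMaynardSieveConst01651
GENERATED by the gate from the ledger (D-0016/17). Provers cite these decls: `theorem foo : Summit.Parity.GeneralizedHardyLittlewood.Theses.FordMaynardSieveConst01651.<Decl> := …` in Summits/Parity/GeneralizedHardyLittlewood/Theorems/<Name>.lean.
-/

namespace Summit.Parity.GeneralizedHardyLittlewood.Theses.FordMaynardSieveConst01651

open scoped BigOperators Topology Manifold Classical MeasureTheory ProbabilityTheory Matrix InnerProductSpace ComplexConjugate ContinuousMap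
open Filter Set Function TopologicalSpace MeasureTheory

attribute [summit_statement] _root_.GeneralizedHardyLittlewood
-- H21.Audit: the closer leaf Summit.Parity.GeneralizedHardyLittlewood.Theses.FordMaynardSieveConst01651.SieveConst01651 is an item decl of this route file — tagged summit_statement below, after its declaration

/-! Retired items kept as plain definitions (history; not obligations of this route): landed proofs / closed glue still name them. -/

-- tombstone: stmt-Parity-19186 was DROPPED from this route but is still named by active items / landed proofs — kept as a plain def (no route_item tag), not an obligation of this route
/-- retired stmt-Parity-19186 (dropped, gen None) — refuted by Summit.Parity.GeneralizedHardyLittlewood.Theorems.FordMaynardSieveConst01651GCert01651_refuted. -/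
def GCert01651 : Prop :=
  ∃ g : Literature.NumberTheory.Sieve.FordMaynard.VecFn, g.IsSymmetric ∧ Literature.NumberTheory.Sieve.FordMaynard.IsPiecewiseConstOnCone g ∧ (∀ e : Fin 0 → ℝ, g 0 e = 1) ∧ (∀ (k : ℕ) (x : Fin k → ℝ), g k x ≠ 0 → k = 0 ∨ ((∀ i, (1651 / 10000 : ℝ) < x i) ∧ ∑ i, x i < 1 / 2)) ∧ (∀ k : ℕ, 2 ≤ k → ∀ x : Fin k → ℝ, (∀ i, (1651 / 10000 : ℝ) < x i ∧ x i < 1 - 1651 / 10000) → ∑ i, x i = 1 → Literature.NumberTheory.Sieve.FordMaynard.starSum g k x ≤ 0) ∧ 0 < Literature.NumberTheory.Sieve.FordMaynard.sieveBoundG1 (1651 / 10000) g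

/-- item stmt-Parity-19185 · target · rank 0 · closed · proved by Summit.Parity.GeneralizedHardyLittlewood.Theses.FordMaynardSieveConst01651.sieveConst01651_proof (prover) · by planner
why it might fail: only if the certificate GCert01651 is wrong (V-margin 2.7·10⁻³) or the named fact Theorem 7.3 (a) is mis-transcribed — the bridge is declared.
sources: FordMaynard2024PrimeSieves, arXiv:2407.14368
[target] the rung leaf itself, as this route's target item: for every ν ∈ [0.1651, 1/3) some c > 0
is an admissible lower-bound linear-sieve constant at (1/2, 0, ν) — identical by `rfl` to the
operator leaf `Summit.Parity.GeneralizedHardyLittlewood.LowerSieveThreshold01651` if/when that is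
landed; registered (or to be registered) as the rung's ALT-CLOSER (D-0061), after which `route edit
--closes-target` makes the route served. -/
@[route_item "route-Parity-FordMaynardSieveConst01651"]
def SieveConst01651 : Prop :=
  Literature.NumberTheory.Sieve.FordMaynard.LowerSieveThresholdAt (1651 / 10000)

-- `SieveConst01651` holds: proved by `Summit.Parity.GeneralizedHardyLittlewood.Theses.FordMaynardSieveConst01651.sieveConst01651_proof` (its module imports this route file, so no `_holds` link can be stated here).

/-- item stmt-Parity-27432 · crux · rank 2 · closed · proved by Summit.Parity.GeneralizedHardyLittlewood.Theses.FordMaynardSieveConst01651.gCert01651R_proof (planner) · by planner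
[crux] repaired GCert01651 (stmt-Parity-19186, closed·refuted 2026-08-31 by
Summit.Parity.GeneralizedHardyLittlewood.Theorems.FordMaynardSieveConst01651GCert01651_refuted,
class refuted-misstated «< for ≤», witness x = (1/2, 1/2)): the SAME certified (𝟙⋆g)-certificate at
ν = 0.1651 — a symmetric vector function g, piecewise constant on convex polytopes of the ordered
cone, g(∅) = 1, supported (apart from ∅) on vectors with all xᵢ > 0.1651 and Σ xᵢ ≤ 1/2 (the printed
CLOSED support clause of Ford–Maynard (7.1) p. 27, cf. §8.2 p. 47, g(x) = −𝟙(x ≤ 1/2)), with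
(𝟙⋆g)(x) ≤ 0 for every k ≥ 2 and every x with Σ xᵢ = 1 and all xᵢ ∈ (0.1651, 0.8349), and V(0.1651,
g) = sieveBoundG1 (1651/10000) g > 0 (the cell's certified LP optimiser, spec spec_lp_01651_72.json,
kit j242906: 153 050 cell types FAIL = 0 in exact rationals, V = 0.002706498 ± 3.7·10⁻¹⁰). The
refuting witness misses this statement: with the closed clause the one-coordinate subvectors (1/2)
may carry g₁(1/2) ≤ −1/2 (Legendre-type datum g₁ = −1 on (0.1651, 1/2] gives (𝟙⋆g)(1/2,1/2) = −1;
clauses 1–5 jointly satisfiable, HOME/decomp-parity-writer-1/repair-g23/RepairSketch.lean). Why it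
might fail: V-margin only 2.7·10⁻³; the sign -/
@[route_item "route-Parity-FordMaynardSieveConst01651", crux]
def GCert01651R : Prop :=
  ∃ g : Literature.NumberTheory.Sieve.FordMaynard.VecFn, g.IsSymmetric ∧ Literature.NumberTheory.Sieve.FordMaynard.IsPiecewiseConstOnCone g ∧ (∀ e : Fin 0 → ℝ, g 0 e = 1) ∧ (∀ (k : ℕ) (x : Fin k → ℝ), g k x ≠ 0 → k = 0 ∨ ((∀ i, (1651 / 10000 : ℝ) < x i) ∧ ∑ i, x i ≤ 1 / 2)) ∧ (∀ k : ℕ, 2 ≤ k → ∀ x : Fin k → ℝ, (∀ i, (1651 / 10000 : ℝ) < x i ∧ x i < 1 - 1651 / 10000) → ∑ i, x i = 1 → Literature.NumberTheory.Sieve.FordMaynard.starSum g k x ≤ 0) ∧ 0 < Literature.NumberTheory.Sieve.FordMaynard.sieveBoundG1 (1651 / 10000) g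

-- `GCert01651R` holds: proved by `Summit.Parity.GeneralizedHardyLittlewood.Theses.FordMaynardSieveConst01651.gCert01651R_proof` (its module imports this route file, so no `_holds` link can be stated here).

/-- item stmt-Parity-19187 · aside · rank 9 · closed · moot by None · by planner
sources: FordMaynard2024PrimeSieves, arXiv:2407.14368
[support] the declared bridge — Ford–Maynard Theorem 7.3 (a) at P = (1/2, 0, ν), 0 < ν < 1/4, for
symmetric g piecewise constant on polytopes of the ordered cone (named Literature fact, p406831; a
printed theorem whose 20-page proof, §7 with §4–5, is unformalised). Kept as an item so that the
deciding theorem names it; closing it = formalising FM §7. [difficulty: XL] -/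
@[route_item "route-Parity-FordMaynardSieveConst01651"]
def FMThm73aLevelHalf : Prop :=
  Literature.NumberTheory.Sieve.FordMaynard.FordMaynard2024_thm73a_levelHalf

/-- item stmt-Parity-27433 · support · rank 9 · closed · moot by None · by planner
[support] repaired bridge FMThm73aLevelHalf (stmt-Parity-19187 is VACUOUSLY TRUE as typed — strict
support clause, Cruxes/FMThm73aLevelHalf/Lines/closed_point.lean; operator RULING cell INBOX l.294
(2): the vacuous _holds is NOT landed, the item is restated with ≤): Ford–Maynard Theorem 7.3 (a) at
P = (1/2, 0, ν), 0 < ν < 1/4, for symmetric g piecewise constant on convex polytopes of the ordered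
cone with g(∅) = 1, supported (apart from ∅) on all xᵢ > ν and Σ xᵢ ≤ 1/2 (the printed CLOSED clause
(7.1) p. 27), (𝟙⋆g) ≤ 0 on ℋ(P) = {k ≥ 2, Σ xᵢ = 1, ν < xᵢ < 1 − ν} (Lemma 8.4) ⇒ every c < V(ν, g)
= sieveBoundG1 ν g is an admissible lower-bound linear-sieve constant, IsLowerSieveConst (1/2) 0 ν
c. By definition the NEW named Literature fact FordMaynard2024_thm73a_levelHalf_le (p825368,
Literature/NumberTheory/Sieve/FordMaynardSieveBoundG1.lean l.146; corollary .exists_pos l.157; it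
implies the strict decl via FordMaynard2024_thm73a_levelHalf_of_le l.169) — the route's load-bearing
declared bridge after the repair (operator: please re-point conditional_on to this decl). Kept as an
item so that the deciding theorem names it; closing it = formalising Ford–Maynard §7 (with §§4–5), a
printed -/
@[route_item "route-Parity-FordMaynardSieveConst01651", crux]
def FMThm73aLevelHalfR : Prop :=
  Literature.NumberTheory.Sieve.FordMaynard.FordMaynard2024_thm73a_levelHalf_le

/-- item stmt-Parity-19188 · assembly · rank 1 · closed · proved by Summit.Parity.GeneralizedHardyLittlewood.Theses.FordMaynardSieveConst01651.assembly_holds (prover) · by planner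
sources: FordMaynard2024PrimeSieves
[assembly] GCert01651 → FMThm73aLevelHalf → LowerSieveThreshold01651. -/
@[route_item "route-Parity-FordMaynardSieveConst01651"]
def Assembly : Prop :=
  GCert01651 → FMThm73aLevelHalf → SieveConst01651

-- `Assembly` holds: proved by `Summit.Parity.GeneralizedHardyLittlewood.Theses.FordMaynardSieveConst01651.assembly_holds` (its module imports this route file, so no `_holds` link can be stated here).

-- records of items no longer active in this route (dropped / restated):
-- earlier GCert01651 (stmt-Parity-19186, dropped 2026-08-31T15:27:10Z): refuted by Summit.Parity.GeneralizedHardyLittlewood.Theorems.FordMaynardSieveConst01651GCert01651_refuted — ∃ g : Literature.NumberTheory.Sieve.FordMaynard.VecFn, g.IsSymmetric ∧ Literature.NumberTheory.Sieve.FordMaynard.IsPiecewiseConstOnCone g ∧ (∀ e : Fin 0 → ℝ, g 0 e = 1) ∧ (∀ (k : ℕ) (x : Fin k → ℝ), g k x ≠ 0 → k = 0 ∨ ((∀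

attribute [summit_statement] _root_.Summit.Parity.GeneralizedHardyLittlewood.Theses.FordMaynardSieveConst01651.SieveConst01651

/-! D-0027 §2.1 — DECIDING THEOREM (planner-authored via `route open/edit --closes-file`; by planner-decomp-parity-writer-1-g24-0 2026-08-31T15:26:31Z) — ARCHIVED: route closed (proved) 2026-09-01T00:28:58Z; kept so importers keep building:
its hypotheses are this route's items and its conclusion the registered leaf `Summit.Parity.GeneralizedHardyLittlewood.Theses.FordMaynardSieveConst01651.SieveConst01651` (rung F-P1, D-0061) (glue_lint), and it elaborates with this file. -/

@[closes "route-Parity-FordMaynardSieveConst01651"] theorem closes (h1 : GCert01651R) (h2 : FMThm73aLevelHalfR) : SieveConst01651 := by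
  intro ν hν _hν3
  obtain ⟨g, hs, hpc, h0, hsupp, hH, hV⟩ := h1
  refine ⟨Literature.NumberTheory.Sieve.FordMaynard.sieveBoundG1 (1651 / 10000) g / 2, by linarith, ?_⟩
  exact (h2 (1651 / 10000) (by norm_num) (by norm_num) g hs hpc h0 hsupp hH _ (by linarith)).mono hν

end Summit.Parity.GeneralizedHardyLittlewood.Theses.FordMaynardSieveConst01651
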